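import Mathlib
import Summits.Ventures.PercRepro.TriangleCapSubBand

/-!
# PercRepro — THE FIRST GAP OF THE BAND ON `n` VERTICES: NO VALUE `ℓ ≤ j ≤ t − 3` (p3, gen 52; part 253)

On `n = ℓ + 1 + (s − t)` vertices (`ℓ` non-neighbours of the vertex `w` of degree `s − t`) the band `t` of the
pair-count spectrum of the triangle-free graphs with `s` edges is NOT an interval: below its extremal value
(part 248) the values `ℓ ≤ j ≤ t − 3` are never attained.  Either the `t` off-edges form a star at a vertex `x` —
then `2·attach + t (t − 1) + 2 j = t (t + 1)` gives `j = t − attach`, and `attach ≥ t − (ℓ − 1)` because the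
off-edges missing `N(w)` inject into the non-neighbours other than `x` by their second end (`x ∈ N(w)` forces
`attach = t`) — so `j ≤ ℓ − 1`; or no vertex carries all off-edges, and the sub-band lower bound of part 252 gives
`j ≥ t − 2` (`band_ge_of_not_star`).  Hence `j + 1 ≤ ℓ ∨ t ≤ j + 2` (`first_gap`, `first_gap_vertices`) and the
band values `ℓ ≤ j ≤ t − 3` are not attained on `ℓ + 1 + (s − t)` vertices (`first_gap_not_attained`) — the
interval property of the middle regime (part 251) stops exactly where `ℓ + 3 ≤ t`.  Axioms: standard.
-/

namespace PercRepro

namespace TriangleCap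

namespace C047

open Finset

variable {V : Type*} [Fintype V] [DecidableEq V]

/-- The non-neighbours of `w` other than `w`. -/
def nonNbrs (H : SimpleGraph V) [DecidableRel H.Adj] (w : V) : Finset V :=
  (univ.erase w).filter (fun v => ¬ H.Adj w v)

/-- Membership in `nonNbrs`. -/
theorem mem_nonNbrs (H : SimpleGraph V) [DecidableRel H.Adj] (w v : V) :
    v ∈ nonNbrs H w ↔ v ≠ w ∧ ¬ H.Adj w v := by
  unfold nonNbrs
  rw [mem_filter, mem_erase]
  simp only [mem_univ, and_true]

/-- `|nonNbrs| + d(w) + 1 = |V|`. -/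
theorem card_nonNbrs_add (H : SimpleGraph V) [DecidableRel H.Adj] (w : V) :
    (nonNbrs H w).card + deg H w + 1 = Fintype.card V := by
  have h1 : ((univ : Finset V).erase w).filter (fun v => H.Adj w v) = univ.filter (fun v => H.Adj w v) := by
    ext v
    simp only [mem_filter, mem_erase, mem_univ, true_and, and_true]
    constructor
    · rintro ⟨-, h⟩
      exact h
    · intro h
      exact ⟨fun hv => H.irrefl (hv ▸ h), h⟩
  have h2 := card_filter_add_card_filter_not (s := (univ : Finset V).erase w) (fun v => H.Adj w v)
  rw [h1, card_erase_of_mem (mem_univ w), card_univ] at h2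
  have h3 : 0 < Fintype.card V := Fintype.card_pos_iff.mpr ⟨w⟩
  unfold nonNbrs deg
  omega

/-- The off-edges of `w` missing `N(w)` entirely. -/
def insideEdges (H : SimpleGraph V) [DecidableRel H.Adj] (w : V) : Finset (Sym2 V) :=
  (offEdges H w).filter (fun e => (univ.filter (fun v => H.Adj w v ∧ v ∈ e)).card = 0)

/-- Membership in `insideEdges`: an off-edge none of whose ends is a neighbour of `w`. -/
theorem mem_insideEdges (H : SimpleGraph V) [DecidableRel H.Adj] (w : V) (e : Sym2 V) :
    e ∈ insideEdges H w ↔ e ∈ offEdges H w ∧ ∀ v, v ∈ e → ¬ H.Adj w v := by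
  unfold insideEdges
  rw [mem_filter, card_eq_zero, filter_eq_empty_iff]
  constructor
  · rintro ⟨h1, h2⟩
    exact ⟨h1, fun v hv hadj => h2 (mem_univ v) ⟨hadj, hv⟩⟩
  · rintro ⟨h1, h2⟩
    exact ⟨h1, fun v _ ⟨hadj, hv⟩ => h2 v hv hadj⟩

/-- **`attach` counts at least the off-edges meeting `N(w)`:** `|F| ≤ attach + |insideEdges|`. -/
theorem card_offEdges_le_attach_add_inside (H : SimpleGraph V) [DecidableRel H.Adj] (w : V) :
    (offEdges H w).card ≤ attach H w + (insideEdges H w).card := by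
  rw [attach_eq_sum_card]
  have hsplit := card_filter_add_card_filter_not (s := offEdges H w)
    (fun e => (univ.filter (fun v => H.Adj w v ∧ v ∈ e)).card = 0)
  have hle : ((offEdges H w).filter
      (fun e => ¬ (univ.filter (fun v => H.Adj w v ∧ v ∈ e)).card = 0)).card ≤
      ∑ e ∈ offEdges H w, (univ.filter (fun v => H.Adj w v ∧ v ∈ e)).card := by
    rw [card_eq_sum_ones]
    calc ∑ _e ∈ (offEdges H w).filter (fun e => ¬ (univ.filter (fun v => H.Adj w v ∧ v ∈ e)).card = 0), 1
        ≤ ∑ e ∈ (offEdges H w).filter (fun e => ¬ (univ.filter (fun v => H.Adj w v ∧ v ∈ e)).card = 0),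
            (univ.filter (fun v => H.Adj w v ∧ v ∈ e)).card := by
          apply sum_le_sum
          intro e he
          have := (mem_filter.mp he).2
          omega
      _ ≤ ∑ e ∈ offEdges H w, (univ.filter (fun v => H.Adj w v ∧ v ∈ e)).card :=
          sum_le_sum_of_subset (filter_subset _ _)
  unfold insideEdges
  omega

/-- The second end of an edge containing `x` (`x` itself when `x ∉ e`). -/
noncomputable def otherEnd (x : V) (e : Sym2 V) : V := if h : x ∈ e then Sym2.Mem.other h else x

/-- When all off-edges contain the non-neighbour `x`, the off-edges missing `N(w)` inject into the non-neighbours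
other than `x` by their second end: `|insideEdges| + 1 ≤ |nonNbrs|`. -/
theorem card_insideEdges_succ_le_of_star (H : SimpleGraph V) [DecidableRel H.Adj] (w x : V)
    (hall : ∀ e ∈ offEdges H w, x ∈ e) (hxw : ¬ H.Adj w x) (hxw' : x ≠ w) :
    (insideEdges H w).card + 1 ≤ (nonNbrs H w).card := by
  have hx : x ∈ nonNbrs H w := (mem_nonNbrs H w x).mpr ⟨hxw', hxw⟩
  have h1 : (insideEdges H w).card ≤ ((nonNbrs H w).erase x).card := by
    apply card_le_card_of_injOn (otherEnd x)
    · intro e he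
      rw [mem_coe] at he ⊢
      have he' := (mem_insideEdges H w e).mp he
      have hxe := hall e he'.1
      have hne := mem_edgeFinset_of_mem_offEdges H w he'.1
      have hdiag : ¬ e.IsDiag := H.not_isDiag_of_mem_edgeSet (SimpleGraph.mem_edgeFinset.mp hne)
      unfold otherEnd
      rw [dif_pos hxe, mem_erase, mem_nonNbrs]
      refine ⟨Sym2.other_ne hdiag hxe, ?_, he'.2 _ (Sym2.other_mem hxe)⟩
      intro hw
      exact notMem_of_mem_offEdges H w he'.1 (hw ▸ Sym2.other_mem hxe)
    · intro e he e' he' heq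
      rw [mem_coe] at he he'
      have hxe := hall e ((mem_insideEdges H w e).mp he).1
      have hxe' := hall e' ((mem_insideEdges H w e').mp he').1
      unfold otherEnd at heq
      rw [dif_pos hxe, dif_pos hxe'] at heq
      rw [← Sym2.other_spec hxe, ← Sym2.other_spec hxe', heq]
  rw [card_erase_of_mem hx] at h1
  have : 0 < (nonNbrs H w).card := card_pos.mpr ⟨x, hx⟩
  omega

/-- When the off-edges form a star at `x`, `offAdjPairs = t (t − 1)`. -/
theorem offAdjPairs_eq_of_star (H : SimpleGraph V) [DecidableRel H.Adj] (w x : V) (t : ℕ)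
    (ht : (offEdges H w).card = t) (hx : offDeg H w x = t) (ht1 : 1 ≤ t) :
    offAdjPairs H w = t * (t - 1) := by
  have h1 := offAdjPairs_add_le H w
  rw [ht] at h1
  have hxw : x ≠ w := by
    intro h
    rw [h, offDeg_self] at hx
    omega
  have h2 : offDeg H w x * (offDeg H w x - 1) ≤ offAdjPairs H w := by
    rw [← sum_erase_offDeg_mul_pred]
    exact single_le_sum (f := fun v => offDeg H w v * (offDeg H w v - 1)) (fun _ _ => Nat.zero_le _)
      (mem_erase.mpr ⟨hxw, mem_univ x⟩)
  rw [hx] at h2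
  have e3 : t * t = t * (t - 1) + t := mul_self_eq_mul_pred_add t
  omega

/-- **THE STAR CASE:** at the band value `2 j` with all `t ≥ 1` off-edges at one vertex `x`, `j + 1 ≤ |nonNbrs|`. -/
theorem band_succ_le_of_star (H : SimpleGraph V) [DecidableRel H.Adj] (hfree : H.CliqueFree 3) (s t j : ℕ)
    (hs : H.edgeFinset.card = s) (w : V) (hw : 1 ≤ deg H w) (ht : (offEdges H w).card = t)
    (hj : ∑ v, deg H v * deg H v + 2 * (t * (s - t - 1)) + 2 * j = s * (s + 1)) (x : V)
    (hx : offDeg H w x = t) (ht1 : 1 ≤ t) : j + 1 ≤ (nonNbrs H w).card := by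
  have hall : ∀ e ∈ offEdges H w, x ∈ e := by
    have hfull : (offEdges H w).filter (fun e => x ∈ e) = offEdges H w :=
      eq_of_subset_of_card_le (filter_subset _ _) (by unfold offDeg at hx; omega)
    intro e he
    rw [← hfull] at he
    exact (mem_filter.mp he).2
  have hP := offAdjPairs_eq_of_star H w x t ht hx ht1
  have hval := (layer_value_iff H s t j hs w hw ht).mp hj
  rw [hP] at hval
  have e3 : t * (t + 1) = t * (t - 1) + 2 * t := by
    rcases t with _ | t
    · simp
    · rw [Nat.add_sub_cancel]
      ring
  have hatt := card_offEdges_le_attach_add_inside H w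
  rw [ht] at hatt
  by_cases hxN : H.Adj w x
  · -- every off-edge meets `N(w)` at `x`: no inside edge, and a non-neighbour exists
    have hins : (insideEdges H w).card = 0 := by
      rw [card_eq_zero, eq_empty_iff_forall_notMem]
      intro e he
      have he' := (mem_insideEdges H w e).mp he
      exact he'.2 x (hall e he'.1) hxN
    have hℓ : 1 ≤ (nonNbrs H w).card := by
      obtain ⟨e, he⟩ := card_pos.mp (by omega : 0 < (offEdges H w).card)
      have hxe := hall e he
      have hne := mem_edgeFinset_of_mem_offEdges H w he
      have hdiag : ¬ e.IsDiag := H.not_isDiag_of_mem_edgeSet (SimpleGraph.mem_edgeFinset.mp hne)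
      have hone := card_adj_mem_le_one H hfree w e hne
      have hy : ¬ H.Adj w (Sym2.Mem.other hxe) := by
        intro hy
        have : 1 < (univ.filter (fun v => H.Adj w v ∧ v ∈ e)).card :=
          one_lt_card.mpr ⟨x, mem_filter.mpr ⟨mem_univ _, hxN, hxe⟩, Sym2.Mem.other hxe,
            mem_filter.mpr ⟨mem_univ _, hy, Sym2.other_mem hxe⟩, (Sym2.other_ne hdiag hxe).symm⟩
        omega
      have hyw : Sym2.Mem.other hxe ≠ w := by
        intro hw'
        exact notMem_of_mem_offEdges H w he (hw' ▸ Sym2.other_mem hxe)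
      exact card_pos.mpr ⟨_, (mem_nonNbrs H w _).mpr ⟨hyw, hy⟩⟩
    omega
  · have hxw : x ≠ w := by
      intro h
      rw [h, offDeg_self] at hx
      omega
    have := card_insideEdges_succ_le_of_star H w x hall hxN hxw
    omega

/-- **THE FIRST GAP:** a triangle-free graph with `s` edges and a vertex `w` with `t` off-edges at the band value
`2 j` has `j + 1 ≤ |nonNbrs w|` or `t ≤ j + 2`: no band value `ℓ ≤ j ≤ t − 3` with `ℓ` non-neighbours. -/
theorem first_gap (H : SimpleGraph V) [DecidableRel H.Adj] (hfree : H.CliqueFree 3) (s t j : ℕ)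
    (hs : H.edgeFinset.card = s) (w : V) (hw : 1 ≤ deg H w) (ht : (offEdges H w).card = t)
    (hj : ∑ v, deg H v * deg H v + 2 * (t * (s - t - 1)) + 2 * j = s * (s + 1)) :
    j + 1 ≤ (nonNbrs H w).card ∨ t ≤ j + 2 := by
  rcases Nat.eq_zero_or_pos t with rfl | ht1
  · right
    omega
  by_cases hstar : ∃ x, offDeg H w x = t
  · obtain ⟨x, hx⟩ := hstar
    left
    exact band_succ_le_of_star H hfree s t j hs w hw ht hj x hx ht1
  · right
    simp only [not_exists] at hstar
    exact band_ge_of_not_star H hfree s t j hs w hw ht hj hstar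

/-- **THE FIRST GAP ON `n` VERTICES:** on `ℓ + 1 + (s − t)` vertices, at the band value `2 j` of a vertex of degree
`s − t ≥ 1`, `j + 1 ≤ ℓ ∨ t ≤ j + 2`. -/
theorem first_gap_vertices (ℓ s t : ℕ) (H : SimpleGraph (Fin (ℓ + 1 + (s - t)))) [DecidableRel H.Adj]
    (hfree : H.CliqueFree 3) (hs : H.edgeFinset.card = s) (w : Fin (ℓ + 1 + (s - t))) (hw : deg H w + t = s)
    (hw1 : 1 ≤ deg H w) (j : ℕ) (hj : ∑ v, deg H v * deg H v + 2 * (t * (s - t - 1)) + 2 * j = s * (s + 1)) :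
    j + 1 ≤ ℓ ∨ t ≤ j + 2 := by
  have hc := card_nonNbrs_add H w
  rw [Fintype.card_fin] at hc
  have hcard := card_offEdges_add_deg H w
  have := first_gap H hfree s t j hs w hw1 (by omega) hj
  omega

/-- **THE BAND ON `n` VERTICES IS NOT AN INTERVAL:** for `1 ≤ t`, `2 t ≤ s`, no triangle-free graph on
`ℓ + 1 + (s − t)` vertices with `s` edges and a vertex of degree `s − t` has the band value `2 j` with
`ℓ ≤ j ≤ t − 3`. -/
theorem first_gap_not_attained (ℓ s t j : ℕ) (ht : 1 ≤ t) (hs : 2 * t ≤ s) (hℓ : ℓ ≤ j) (hj : j + 3 ≤ t) :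
    ¬ ∃ (H : SimpleGraph (Fin (ℓ + 1 + (s - t)))) (_ : DecidableRel H.Adj), H.CliqueFree 3 ∧
      H.edgeFinset.card = s ∧ (∃ w, deg H w + t = s) ∧
      ∑ v, deg H v * deg H v + 2 * (t * (s - t - 1)) + 2 * j = s * (s + 1) := by
  rintro ⟨H, _, hfree, hs', ⟨w, hw⟩, hj'⟩
  have := first_gap_vertices ℓ s t H hfree hs' w hw (by omega) j hj'
  omega

end C047

end TriangleCap

end PercRepro
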